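import Summits.Ventures.HSemireg.SecantParityPositivity
import Summits.Ventures.HSemireg.SecantParityPairing
import HarnessLib

/-!
# Venture HSemireg — the SIGN of the χ-pairing of a `K`-secant class with a polarisation-type exponent (TRACK S4-PUSH (ii),
# seat `s4-prove-1`; composition leaf of `SecantParityPositivity.lean` (ATTEMPT-1) and `SecantParityPairing.lean` (ATTEMPT-2);
# files of record `s4push/prove-1/ATTEMPT-1.md` §1/§3, `STATEMENTS-S3INPUT.md` S3INP-2/S3INP-5, `theory/FORMULA-N-th7.md` §D)

HONEST FRAMING. Lean index of the computation cell `pub-hsemireg`. FINITE-DIMENSIONAL EXTERIOR ALGEBRA ONLY: it composes the two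
kernel files — `τ(β_hᵍ) = g!·det h` for the `(1,1)`-form with Hermitian coefficient matrix `h` (`SecantParityPositivity`) and
`τ(v^∨ v) = 2(xc)(yc')(-4d)ᵐ·τ(βᵍ)/g!` for the secant element `v = xc·e^{a+tβ} + yc'·e^{a-tβ}` (`SecantParityPairing`).  No abelian
variety, sheaf, Euler pairing or Ext group is constructed; that `τ(v^∨ v)` IS `χ(F,F)` (HRR), that `h` positive definite IS «`b` a
polarisation» (Lange 2023 §2.1.1) and that `(xc)(yc') = |xc|² > 0` says only «the secant vector is non-zero» (`y = x̄`, `c' = c̄`;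
s4-ref P-1) are the PAPER dictionary.  STATUS WORD (s4-ref P-2): (S3) stays «PROVED given `∫bⁿ > 0` [th-7 §D on paper; scalar chain +
sign law KERNEL-CHECKED]».  Nothing here says that HC, HC_CM or HC_AV holds; nothing here is a new case of anything.

CONTENT (all PROVED, 0 sorry, no definitions, no named facts), namespace `Summit.Ventures.HSemireg.SecantParity`:
`trace_secantDual_mul_secant_oneOneForm_even` — `τ(v^∨ v) = 2(xc)(yc')(-4d)ᵐ·det h` (`g = 2m ≥ 2`, `t² = -d`);
`neg_one_pow_mul_trace_secant_pos_of_posDef` — `h` positive definite, `(xc)(yc') > 0`, `d > 0` ⇒ `0 < (-1)ᵐ·τ(v^∨ v)` (th-7's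
«SIGN `(-1)^{n/2}`» for a polarisation `b`: the (S3) contradiction with `χ^G = -2` at `n ≡ 0 (mod 4)`, consistency at `n ≡ 2 (mod 4)`);
`sign_law_of_posDef` — the SHAPE `Even n → 0 < (-1)^(n/2)·vv` of the tree's `FormulaNUniformLaw.ParityDatum.sign_law` ((H1) BY VALUE
there) DISCHARGED in the wedge model for any integer `vv` realised as `τ(v^∨ v)` with `h` positive definite; an `example` replays th-7's
checker numbers `-6, 48, -384` (`d = 2`, `w = 3/8`, `m = 1, 2, 3`; the item ref-4 13:46:16Z had not checked).

## References

* [Lange2023AbelianVarietiesComplex] H. Lange, Abelian Varieties over the Complex Numbers (2023), Thm. 1.7.1, Thm. 1.7.3, §2.1.1.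
* [Markman2025SecantWeil] E. Markman, arXiv:2502.03415 (UNREFEREED), §2.2, Assumption 2.4.1.
* th-7, theory/FORMULA-N-th7.md §D (Σ6) and its checker formula_n_check.py §(4); ref-4 13:46:16Z; s4-ref VERDICT-PROVE-S3-LEAN-2026-08-23.md.
-/

noncomputable section

namespace Summit.Ventures.HSemireg

namespace SecantParity

open ExteriorAlgebra
open Literature.AlgebraicGeometry.Motives.ExteriorLefschetz (twoVector trace)

section Composition

open scoped ComplexOrder

variable {W : Type*} [AddCommGroup W] [Module ℂ W] {g : ℕ} (b : Module.Basis (Fin g ⊕ Fin g) ℂ W)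

/-- **COMPOSITION with `SecantParityPositivity`** (th-7 §D with `∫_X bⁿ` evaluated): for `β = β_h` the `(1,1)`-form with
Hermitian coefficient matrix `h` in the frame (`oneOneForm b h`, `τ(β_hᵍ) = g!·det h`), `g = 2m ≥ 2`, `t² = -d`:
`τ(v^∨ · v) = 2 (xc)(yc') (-4d)ᵐ · det h`.  On paper (`y = x̄`, `c' = c̄`, `d > 0`): sign `= (-1)ᵐ · sign(det h) =
(-1)^{m + index(b)}` — the signed parity constraint of ATTEMPT-1 §3, modulo HRR and the Ext profile.
[cite: Lange2023AbelianVarietiesComplex, Thm. 1.7.1 and Thm. 1.7.3] -/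
theorem trace_secantDual_mul_secant_oneOneForm_even {m : ℕ} (hg : g = 2 * m) (hm : 0 < m) (x y c c' t d : ℂ)
    (ht : t ^ 2 = -d) {a : ExteriorAlgebra ℂ W} (ha : a ∈ ⋀[ℂ]^2 W) (h : Matrix (Fin g) (Fin g) ℂ) :
    trace (twoVector b) g
        (secantDual g x y c c' t a (oneOneForm b h) * secant g x y c c' t a (oneOneForm b h)) =
      2 * ((x * c) * (y * c')) * (-4 * d) ^ m * h.det := by
  rw [trace_secantDual_mul_secant_even b hg hm x y c c' t d ht ha (oneOneForm_mem_two b h), trace_oneOneForm_pow,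
    inv_mul_cancel_left₀ (Nat.cast_ne_zero.mpr (Nat.factorial_pos g).ne')]

/-- … and its SIGN when `h` is positive definite (index `0`), `w := (xc)(yc')` and `d` are positive reals:
`(-1)ᵐ · τ(v^∨ · v) = 2 w (4d)ᵐ det h > 0` — th-7's «SIGN `(-1)^{n/2}`» for `b` a polarisation; so at `n = 2m ≡ 0 (mod 4)`
the pairing is POSITIVE (the (S3) contradiction with `χ^G = -2`), at `n ≡ 2 (mod 4)` NEGATIVE (consistent, `|G| = -(v,v)_χ/2`).
[cite: Lange2023AbelianVarietiesComplex, Thm. 1.7.1 and Thm. 1.7.3] -/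
theorem neg_one_pow_mul_trace_secant_pos_of_posDef {m : ℕ} (hg : g = 2 * m) (hm : 0 < m) {x y c c' t d : ℂ}
    (ht : t ^ 2 = -d) (hw : 0 < (x * c) * (y * c')) (hd : 0 < d) {a : ExteriorAlgebra ℂ W} (ha : a ∈ ⋀[ℂ]^2 W)
    {h : Matrix (Fin g) (Fin g) ℂ} (hh : h.PosDef) :
    0 < (-1) ^ m * trace (twoVector b) g
        (secantDual g x y c c' t a (oneOneForm b h) * secant g x y c c' t a (oneOneForm b h)) := by
  rw [trace_secantDual_mul_secant_oneOneForm_even b hg hm x y c c' t d ht ha h]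
  have key : (-1 : ℂ) ^ m * (2 * ((x * c) * (y * c')) * (-4 * d) ^ m * h.det) =
      2 * ((x * c) * (y * c')) * (4 * d) ^ m * h.det := by
    have h14 : ((-1 : ℂ) * (-4 * d)) ^ m = (4 * d) ^ m := by
      congr 1; ring
    rw [← h14, mul_pow (-1 : ℂ) (-4 * d) m]; ring
  have h2 : (0 : ℂ) < 2 := by exact_mod_cast (by norm_num : (0 : ℝ) < 2)
  have h4 : (0 : ℂ) < 4 := by exact_mod_cast (by norm_num : (0 : ℝ) < 4)
  rw [key]
  exact mul_pos (mul_pos (mul_pos h2 hw) (pow_pos (mul_pos h4 hd) m)) hh.det_pos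


/-- **GLUE to the tree's typed (S3) skeleton** — `Summit.Ventures.HSemireg.FormulaNUniformLaw`'s `ParityDatum.sign_law :
Even n → 0 < (-1) ^ (n / 2) * vv` carries (H1) BY VALUE («GIVEN `∫_X bⁿ > 0` — ARGUED from polarisability»).  In the wedge model,
for a polarisation-type `b` (Hermitian matrix `h` positive definite), `w = (xc)(yc') > 0`, `d > 0`, the sign law HOLDS for any integer
`vv` realised as the model pairing `τ(v^∨ · v)`: this is `neg_one_pow_mul_trace_secant_pos_of_posDef` read back in `ℤ`.
[cite: Lange2023AbelianVarietiesComplex, Thm. 1.7.1 and Thm. 1.7.3] -/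
theorem sign_law_of_posDef {m : ℕ} (hg : g = 2 * m) (hm : 0 < m) {x y c c' t d : ℂ} (ht : t ^ 2 = -d)
    (hw : 0 < (x * c) * (y * c')) (hd : 0 < d) {a : ExteriorAlgebra ℂ W} (ha : a ∈ ⋀[ℂ]^2 W)
    {h : Matrix (Fin g) (Fin g) ℂ} (hh : h.PosDef) {vv : ℤ}
    (hvv : (vv : ℂ) = trace (twoVector b) g
      (secantDual g x y c c' t a (oneOneForm b h) * secant g x y c c' t a (oneOneForm b h))) :
    Even g → 0 < (-1) ^ (g / 2) * vv := by
  intro _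
  have hpos := neg_one_pow_mul_trace_secant_pos_of_posDef b hg hm ht hw hd ha hh
  rw [show g / 2 = m by omega]
  rw [← hvv] at hpos
  have h1 : (0 : ℂ) < ((((-1) ^ m * vv : ℤ) : ℝ) : ℂ) := by
    have h1' : ((((-1) ^ m * vv : ℤ) : ℝ) : ℂ) = (-1) ^ m * (vv : ℂ) := by push_cast; ring
    rw [h1']; exact hpos
  have h2 : (0 : ℝ) < (((-1) ^ m * vv : ℤ) : ℝ) := Complex.zero_lt_real.mp h1
  exact_mod_cast h2

end Composition

end SecantParity

end Summit.Ventures.HSemireg
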